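import Literature.Analysis.FluidPDE.NovackLongitudinalBalance
import Literature.Analysis.FluidPDE.NovackMatrixKernelProofs
import Literature.Analysis.FluidPDE.NovackFluxConcentration
import Literature.Analysis.FluidPDE.NovackPairingLimit
import Literature.Analysis.FluidPDE.NovackMatrixKernelCubicIdentity
import Literature.Analysis.FluidPDE.NovackMatrixKernelTestFieldProofs
import HarnessLib

/-!
# Novack's scale-`ℓ` longitudinal balance: decomposition along the printed proof and assembly

Topic: Analysis/FluidPDE. This file reduces the named fact `Torus.novack2024_longAvg_balance`
(`Literature.Analysis.FluidPDE.NovackLongitudinalBalance`; M. Novack, *Scaling laws and exact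
results in turbulence*, Nonlinearity 37 (2024) 095002, §2 Step 2, (last:one:L:L), Euler case
`ν = 0`, unforced, tested in `(0,T) × T^d`) to the two named step facts that are generic in the
matrix kernel (`Literature.Analysis.FluidPDE.NovackMatrixKernel`: the matrix cubic identity and the
tested momentum equation), everything else being **proved** — the pressure split
(`NovackMatrixKernelProofs`), the explicit smooth kernels `M_{ℓ,γ}` (`NovackKernelFamily`), the
sphere concentration of their flux (`NovackFluxConcentration`) and the limit `γ → 0` of the
left-hand side (`NovackPairingLimit`) — **proves the assembly**
`Torus.novack2024_longAvg_balance_of_steps`, and, feeding it the discharges of the two generic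
facts (`Torus.integral_matKernelFlux_mul_eq_holds` of `NovackMatrixKernelCubicIdentity`,
`Torus.IsDistributionalNSSolutionOn.matSymmTestField_identity_holds` of
`NovackMatrixKernelTestFieldProofs`), **discharges the fact**:
`Torus.novack2024_longAvg_balance_holds`.

## The printed proof and its transcription

Novack's Step 2 (with Step 0) proves (last:one:L:L) as follows. (i) Test the weak formulation
with `(φu)_{M}` and `φ u_{M}` for the tensor kernel `M = T_• φ_{ℓ,γ,κ}` and add ((eq:1), (eq:2),
(withkappa); `κ → 0`) — `Torus.IsDistributionalNSSolutionOn.matSymmTestField_identity`.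
(ii) Rewrite the pressure terms through the potential `∂ᵢ(T^{ik}φ) = ∂ₖζ̃` (first display of Step
2) — **proved**, `Torus.integral_pressure_divergence_matSymmTestField`. (iii) Add (eq:adding) and rewrite the
commutator as the flux `−½∫∂_{y_k}(T^{ij}φ)δuⁱδuʲδuᵏ dy` ((last:one:L), (mess:one)) —
`Torus.integral_matKernelFlux_mul_eq`. Together, for every smooth even symmetric `M` with an
even potential `ζ`: `𝒩_M(ψ) = ∫₀ᵀ∫ ψ 𝒟_M(u)` (`Torus.matPairing_eq_integral_matKernelFlux`,
**proved** here from (i)–(iii)). (iv) Let `γ → 0` on the left ("we first pass to the limit in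
every term … using the integrability assumptions on all involved quantities and the dominated
convergence theorem"; "this choice [of `ζ_{ℓ,γ}`] may be justified by an application of the
dominated convergence theorem") — **proved**, `Torus.tendsto_matPairing_novackKernel_of_test`
(`NovackPairingLimit`): `𝒩_{M_{ℓ,γ}}(ψ) → 𝒩^L_ℓ(ψ) = novackLongPairing T u p ψ ℓ`. (v) Let `γ → 0` on the right: the
flux of `M_{ℓ,γ} = φ_{ℓ,γ}T_L − ζ_{ℓ,γ}T_T` is `∫ 2c_ℓ χ'_{ℓ,γ}(|y|²) (y·δu)³ dy` (the transverse
remainder of (mess:one)–(mess:two) cancels by the (ODE)), which concentrates on the sphere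
`|y| = ℓ` ((DR) → (D:I:ell:0) via (dumber:bound), Appendix Prop. 1):
`∫₀ᵀ∫ψ𝒟_{M_{ℓ,γ}}(u) → −(d/ℓ)∫₀ᵀ∫ ⨍(δu·ω)³(ℓω) ψ` — **proved**,
`Torus.tendsto_integral_matKernelFlux_novackKernel_of_test` (`NovackFluxConcentration`).
(vi) Uniqueness of limits gives (last:one:L:L) — `Torus.novack2024_longAvg_balance_of_steps`.

The one liberty taken with the printed order: Novack passes to `γ = 0` separately in the `• = L`
and `• = T` balances and then subtracts; here the two kernels are combined at `γ > 0` (all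
identities are linear in the kernel) and the single limit `γ → 0` is taken last, which avoids the
`|y|`-singularity of `T_L`, `T_T` at the origin (no cut-off `c_κ`).

## Contents

* `Torus.matPairing_eq_integral_matKernelFlux` (**proved**): steps (i)–(iii) combined, for any
  smooth even symmetric matrix kernel with an even smooth potential, granted the two generic
  facts;
* `Torus.novack2024_longAvg_balance_of_steps` (**proved**): the assembly (vi), granted the two
  generic facts `Torus.integral_matKernelFlux_mul_eq` and
  `Torus.IsDistributionalNSSolutionOn.matSymmTestField_identity` (the two matrix twins of
  Duchon–Robert's printed steps);
* `Torus.novack2024_longAvg_balance_holds` (**proved**): the discharge of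
  `Torus.novack2024_longAvg_balance`, the assembly applied to the proved facts
  `Torus.integral_matKernelFlux_mul_eq_holds` and
  `Torus.IsDistributionalNSSolutionOn.matSymmTestField_identity_holds` (sorry-free, no named fact
  left in the trust base).

## References

* M. Novack, *Scaling laws and exact results in turbulence*, Nonlinearity 37 (2024) 095002,
  arXiv:2310.01375: §2 Step 0 ((eq:1), (eq:2)), Step 1 ((DR), (D:I:ell:0), "pass to the limit
  … dominated convergence"), Step 2 ((withkappa), (last:one:L), (mess:one), (mess:two), (ODE),
  (last:one:L:L), (you:ell:ell)), Appendix Prop. 1 ((dumber:bound)). [Novack2024]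
-/

noncomputable section

open MeasureTheory TopologicalSpace Set Function Filter Metric
open _root_.Topology
open scoped ENNReal NNReal Convolution ContDiff InnerProductSpace RealInnerProductSpace

namespace Literature.Analysis.FluidPDE.Torus

variable {d : Type*} [Fintype d]

/-! ## Steps (i)–(iii): the tested balance at fixed smooth kernel -/

section FixedKernel

variable [DecidableEq d] {T : ℝ} {u : ℝ → UnitAddTorus d → EuclideanSpace ℝ d}
  {p : ℝ → UnitAddTorus d → ℝ}

/-- **Novack's scale balance for a smooth tensor kernel** ((last:one:L) with (mess:one), `ν = 0`,
`f = 0`, tested in `(0,T) × T^d` and doubled): granted the two generic step facts, for an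
unforced distributional Euler solution `(u, p)` with `u ∈ L³`, `p ∈ L^{3/2}`, every smooth, even,
symmetric matrix kernel `M` with a smooth even potential `ζ` and every test function `ψ`
supported in `(0,T)`, `𝒩_M(ψ) = ∫₀ᵀ∫ 𝒟_M(u) ψ`: by the cubic identity
`∫∫𝒟_Mψ = C − D + 2B − 2G` (`B = ∫∫⟪u,u_M⟫⟪u,∇ψ⟫`, `C = ∫∫⟪(u|u_M|²),∇ψ⟫`, `D = ∫∫(|u_M|²)⟪u,∇ψ⟫`,
`G = ∫∫⟪u,(u·∇)Φ_M⟫`), the tested equation `A + G + ∫∫p div Φ_M = 0` (`A = ∫∫⟪u,u_M⟫∂ₜψ`) and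
the pressure split `∫∫p div Φ_M = E + F`, so that `∫∫𝒟_Mψ = 2A + 2B + C − D + 2E + 2F = 𝒩_M(ψ)`. [cite: Novack2024, Sect. 2 Step 2 (last:one:L)–(mess:one)] -/
theorem matPairing_eq_integral_matKernelFlux
    (hAlg : integral_matKernelFlux_mul_eq (d := d))
    (hEq : IsDistributionalNSSolutionOn.matSymmTestField_identity (d := d))
    (hsol : IsDistributionalNSSolutionOn T 0 0 u p)
    (hu3 : ∫⁻ t in Ioo 0 T, ∫⁻ x, ‖u t x‖ₑ ^ 3 < ⊤)
    (hp : ∫⁻ t in Ioo 0 T, ∫⁻ x, ‖p t x‖ₑ ^ (3 / 2 : ℝ) < ⊤)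
    {M : d → d → UnitAddTorus d → ℝ} (hM : ∀ i j, FunctionSpaces.Torus.IsSmooth (M i j))
    (hMev : ∀ i j z, M i j (-z) = M i j z) (hMsymm : ∀ i j, M i j = M j i)
    {ζ : UnitAddTorus d → ℝ} (hζ : FunctionSpaces.Torus.IsSmooth ζ) (hζev : ∀ z, ζ (-z) = ζ z)
    (hpot : ∀ j x, ∑ i, FunctionSpaces.Torus.partialDeriv i (M i j) x =
      FunctionSpaces.Torus.partialDeriv j ζ x)
    {ψ : ℝ → UnitAddTorus d → ℝ} (hψ : FunctionSpaces.Torus.IsSpaceTimeTestIoo T ψ) :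
    matPairing T u p ψ M ζ = ∫ t in Ioo 0 T, ∫ x, matKernelFlux M (u t) x * ψ t x := by
  have hmeas := hsol.1
  have hpmeas := hsol.2.2.1
  have hdiv := hsol.2.2.2.2.1
  have e1 := hAlg hmeas hu3 hdiv hM hMev hMsymm hψ
  have e2 := hEq hsol hu3 hp hM hMev hMsymm hψ
  have e3 := integral_pressure_divergence_matSymmTestField hmeas hu3 hdiv hpmeas hp hM hζ hζev hpot hψ
  rw [zero_mul, add_zero, e3] at e2
  rw [matPairing, e1]
  linarith

end FixedKernel

/-! ## The assembly -/

/-- **Novack 2024, §2 Step 2, (last:one:L:L) assembled from the step facts.** Granted the matrix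
cubic identity and the tested momentum equation (`NovackMatrixKernel`), the named fact
`Torus.novack2024_longAvg_balance` holds: for `0 < γ` the combined kernels `M_{ℓ,γ}` are smooth,
even, symmetric, with the even smooth potential `ζ̃_{ℓ,γ}` (`NovackKernelFamily`), so
`𝒩_{M_{ℓ,γ}}(ψ) = ∫∫ψ𝒟_{M_{ℓ,γ}}(u)` (`matPairing_eq_integral_matKernelFlux`); as `γ → 0⁺` the
left-hand side tends to `𝒩^L_ℓ(ψ)` (`tendsto_matPairing_novackKernel_of_test`) and the right-hand
side to `−(d/ℓ)∫₀ᵀ∫⨍(δu·ω)³(ℓω) ψ` (`tendsto_integral_matKernelFlux_novackKernel_of_test`);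
uniqueness of limits. [cite: Novack2024, Sect. 2 Step 2 (last:one:L:L)] -/
theorem novack2024_longAvg_balance_of_steps [instD : DecidableEq d]
    (hAlg : integral_matKernelFlux_mul_eq (d := d))
    (hEq : IsDistributionalNSSolutionOn.matSymmTestField_identity (d := d)) :
    novack2024_longAvg_balance (d := d) := by
  intro instD' T u₀ u p hd hT hsol hC hu3 hp hu₀ ℓ hℓ hℓ' ψ hψ
  have hinst : instD' = instD := Subsingleton.elim _ _
  subst hinst
  haveI : Nonempty d := Fintype.card_pos_iff.1 (by omega)
  have hsolD : IsDistributionalNSSolutionOn T 0 0 u p := hsol.isDistributionalNSSolutionOn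
  have key : (fun γ => matPairing T u p ψ (novackKernel ℓ γ) (novackPotential d ℓ γ)) =ᶠ[𝓝[>] 0]
      fun γ => ∫ t in Ioo 0 T, ∫ x, matKernelFlux (novackKernel ℓ γ) (u t) x * ψ t x := by
    filter_upwards [self_mem_nhdsWithin] with γ hγ
    exact matPairing_eq_integral_matKernelFlux hAlg hEq hsolD hu3 hp
      (fun i j => isSmooth_novackKernel hℓ hγ i j) (fun i j z => novackKernel_neg ℓ γ i j z)
      (fun i j => novackKernel_comm ℓ γ i j) (isSmooth_novackPotential hℓ hγ)
      (fun z => novackPotential_neg ℓ γ z) (fun j x => sum_partialDeriv_novackKernel hℓ hγ j x) hψ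
  exact tendsto_nhds_unique_of_eventuallyEq
    (tendsto_matPairing_novackKernel_of_test hsolD.1 hu3 hsolD.2.2.1 hp hℓ hψ)
    (tendsto_integral_matKernelFlux_novackKernel_of_test hsolD.1 hu3 hℓ hψ) key

/-! ## The discharge -/

/-- **Discharge of `Torus.novack2024_longAvg_balance`** (Novack 2024, Theorem 1 / §2 Step 2,
(last:one:L:L): the scale-`ℓ` longitudinal balance for an `L³` weak Euler solution with
`L^{3/2}` pressure, tested in `(0,T) × T^d`): the assembly
`novack2024_longAvg_balance_of_steps` fed with the proved matrix cubic identity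
(`integral_matKernelFlux_mul_eq_holds`, (mess:one)) and the proved tested momentum equation for
the matrix-mollified fields (`IsDistributionalNSSolutionOn.matSymmTestField_identity_holds`,
Step 0 (eq:1)–(eq:2)). [cite: Novack2024, Sect. 2 Step 2 (last:one:L:L)] -/
theorem novack2024_longAvg_balance_holds : novack2024_longAvg_balance (d := d) := by
  classical
  exact novack2024_longAvg_balance_of_steps integral_matKernelFlux_mul_eq_holds
    IsDistributionalNSSolutionOn.matSymmTestField_identity_holds

end Literature.Analysis.FluidPDE.Torus
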